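import Literature.Analysis.FluidPDE.ESSLocalHolderBlowupProperties
import HarnessLib

/-!
# The blow-up (zoom-in) limit of a suitable weak solution at a point: a local energy ancient
# solution on `ℝ³ × ]-∞, 0[` (Seregin 2014, Prop. 6.20; used in Seregin 2020, proof of Thm. 2.1)

Analysis/FluidPDE proof file (everything proved; no definitions, no named facts) on the way to
the named fact `Literature.Analysis.FluidPDE.Seregin2020_axisymmetricSingularPoint_typeII`
(`Seregin2020AxisymmetricTypeII.lean`; G. Seregin, Anal. Math. Phys. 10 (2020), Paper 46 =
arXiv:2006.04140, Thm. 2.1). After (2.7)–(2.9) the printed proof continues: "Now, we can rescale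
our function `v` and `q` around the origin as it has been described, for example, in
[SerShi2018], see Theorem 3.5 there. Let `λₖ → 0` be a sequence and let
`uᵏ(y, s) = λₖ v(x, t)`, `pᵏ(y, s) = λₖ² q(x, t)`, where `x = λₖ y` and `t = λₖ² s`. Passing
`k → ∞`, we can find limit functions `u` and `p` of sequences `uᵏ` and `pᵏ` that have the
properties (𝒜): (i) `u` is a local energy ancient solution in `Q₋ = ℝ³ × ]-∞, 0[`, i.e., the pair
`u` and `p` is a suitable weak solution in `Q(R)` for any `R > 0`; …".

The tree carries out exactly this extraction — compactness of suitable weak solutions on the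
unit ball (`SuitableCompactness_holds`, Albritton–Barker 2019, Lemma 2.2 after Lin 1998) at every
level `a = 2ᵐ`, Cantor's diagonal, identification and gluing of the level limits — in
`ESSLocalHolderBlowupExtraction.lean` / `ESSLocalHolderBlowupLimit.lean`, but stated for the
Escauriaza–Seregin–Šverák class `IsL3inftyLocalPair` (`v ∈ L^{3,∞}`), which a Type I singular
solution does not belong to. The ESS hypothesis enters those proofs at three points only: the
rescaled pairs are suitable in the unit ball, their `L³ × L^{3/2}(Q(1))` norms are uniformly
bounded (through `C(r; z₀) ≤ M`, `D(r; z₀) ≤ D`), and the rescaled velocities are measurable. This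
file re-runs the two proofs verbatim with these three facts as hypotheses
(`exists_zoom_blowup_levels`, `exists_zoom_blowup_limit`), which is the generality of Seregin
2014, Prop. 6.20 / Seregin–Shilkin 2018, Thm. 3.5, and the form needed at a Type I singular point
(where `C, D ≤ L₀` by (2.8), `Seregin2020.typeI_singular_scaledEnergies`).

## Contents (namespace `Literature.Analysis.FluidPDE`)

* `aestronglyMeasurable_uncurry_zoom_of` — measurability of the rescaled velocities on `Q(a)`,
  `a μ ≤ 1/2`, from measurability of `v` on `Q(z₀, 1/2)`;
* `eLpNorm_zoom_add_le_of` — the uniform `L³ × L^{3/2}(Q(1))` bound of the rescaled pairs from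
  `C(r; z₀) ≤ M`, `D(r; z₀) ≤ D`, `0 < r ≤ 1/2`;
* `exists_zoom_blowup_levels`, `exists_zoom_blowup_limit` — the extraction at all levels and the
  glued limit on `ℝ³ × ]-∞, 0[`, as in the ESS files;
* `blowup_lintegral_cube_ge_of`, `aestronglyMeasurable_uncurry_zoom_pressure_of`,
  `blowup_cknD_le_of` — the corresponding generalisations of `ESSLocalHolderBlowupProperties.lean`:
  non-triviality `∫_{Q(a)} |w|³ ≥ η a²` of the limit from `C(ρ; z₀) ≥ η`, and `D(a; 0)[π] ≤ D`.

## Mathlib / tree search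

Tree (all used): `exists_diagonal_subsequence`, `level_scale_pos`, `level_scale_le_half`
(`ESSLocalHolderBlowupExtraction.lean`); `zoom_zoom`, `zoom_zoom_origin_inv`,
`eLpNorm_uncurry_zoom`, `memLp_comp_zoom`, `setIntegral_zoom_pressure_mul`,
`IsSuitableWeakSolutionInBall.zoomOut`, `IsSuitableWeakSolutionInBall.congr_ae'`,
`ae_eq_of_tendsto_eLpNorm_sub`, `ae_eq_of_forall_setIntegral_mul_eq`
(`ESSLocalHolderBlowupLimit.lean`); `SuitableCompactness_holds` (`LocalTypeIProofs.lean`);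
`lintegral_cube_zoom`, `lintegral_pressure_zoom`, `zoom_preimage_parabolicCylinder`
(`SuitableWeakInBallTools.lean`). `lean search 'blowup_levels\|blowup_limit'`: only the ESS-class
versions.

## References

* G. Seregin, *Lecture Notes on Regularity Theory for the Navier–Stokes Equations*, World
  Scientific 2014, §6.6, Prop. 6.20. [Seregin2014]
* G. Seregin, T. Shilkin, *Liouville-type theorems for the Navier–Stokes equations*, Russian
  Math. Surveys 73 (2018), Thm. 3.5. [SereginShilkin2018]
* G. Seregin, Anal. Math. Phys. 10 (2020), Paper 46 = arXiv:2006.04140, proof of Thm. 2.1,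
  properties (𝒜). [Seregin2020]
* L. Escauriaza, G. Seregin, V. Šverák, Russ. Math. Surveys 58 (2003), §3 (3.13)–(3.16).
  [EscauriazaSereginSverak2003]
-/

noncomputable section

open MeasureTheory Set Function Filter Topology TopologicalSpace Metric
open scoped NNReal ENNReal

namespace Literature.Analysis.FluidPDE

/-! ### The three inputs in abstract form -/

section Inputs

variable {v : ℝ → EuclideanSpace ℝ (Fin 3) → EuclideanSpace ℝ (Fin 3)}
  {p : ℝ → EuclideanSpace ℝ (Fin 3) → ℝ}

/-- The rescaled velocity `u^μ(s, y) = μ v(t₀ + μ² s, x₀ + μ y)` is a.e. strongly measurable on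
`Q(a)` as soon as `aμ ≤ 1/2`, if `v` is so on `Q(z₀, 1/2) ⊇ Q(z₀, aμ) = Φ_μ(Q(a))`. [folklore] -/
theorem aestronglyMeasurable_uncurry_zoom_of {z₀ : ℝ × EuclideanSpace ℝ (Fin 3)}
    (hv : AEStronglyMeasurable (uncurry v) (volume.restrict (parabolicCylinder (1 / 2) z₀)))
    {μ a : ℝ} (hμ : 0 < μ) (ha : 0 < a) (haμ : a * μ ≤ 1 / 2) :
    AEStronglyMeasurable (uncurry (μ • stPull (μ ^ 2) μ z₀.1 z₀.2 v))
      (volume.restrict (parabolicCylinder a (0 : ℝ × EuclideanSpace ℝ (Fin 3)))) := by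
  have hv' : AEStronglyMeasurable (uncurry v) (volume.restrict (parabolicCylinder (a * μ) z₀)) :=
    hv.mono_measure (Measure.restrict_mono
      (parabolicCylinder_mono (by positivity) haμ z₀) le_rfl)
  have hpre : stAffine (μ ^ 2) μ z₀.1 z₀.2 ⁻¹' parabolicCylinder (a * μ) z₀ =
      parabolicCylinder a (0 : ℝ × EuclideanSpace ℝ (Fin 3)) := by
    rw [zoom_preimage_parabolicCylinder hμ, mul_div_cancel_right₀ a hμ.ne']
  have hcomp : AEStronglyMeasurable (uncurry v ∘ stAffine (μ ^ 2) μ z₀.1 z₀.2)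
      (volume.restrict (parabolicCylinder a (0 : ℝ × EuclideanSpace ℝ (Fin 3)))) := by
    rw [← hpre]
    refine hv'.comp_quasiMeasurePreserving ⟨measurable_stAffine _ _ _ _, ?_⟩
    rw [map_stAffine_volume_restrict_preimage (pow_pos hμ 2) hμ]
    exact Measure.smul_absolutelyContinuous
  have e : uncurry (μ • stPull (μ ^ 2) μ z₀.1 z₀.2 v) =
      μ • (uncurry v ∘ stAffine (μ ^ 2) μ z₀.1 z₀.2) := by
    funext z; rfl
  rw [e]
  exact hcomp.const_smul μ

/-- **Uniform `L³ × L^{3/2}` bound of the rescaled family on `Q(1)`** from bounds of the scaled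
quantities at the centre: `‖u^R‖_{L³(Q(1))} + ‖p^R‖_{L^{3/2}(Q(1))} ≤ M^{1/3} + D^{2/3}` for all
`0 < R ≤ 1/2` if `C(r; z₀) ≤ M` and `D(r; z₀) ≤ D` for `0 < r ≤ 1/2`
(`‖u^R‖³_{L³(Q(1))} = C(R; z₀)`, `‖p^R‖^{3/2}_{L^{3/2}(Q(1))} = D(R; z₀)`). [cite: Seregin2014, §6.6 (the bounds used in Prop. 6.20)] -/
theorem eLpNorm_zoom_add_le_of {z₀ : ℝ × EuclideanSpace ℝ (Fin 3)} {M D : ℝ≥0}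
    (hM : ∀ r ∈ Ioc (0 : ℝ) (1 / 2), cknC r z₀ v ≤ M)
    (hD : ∀ r ∈ Ioc (0 : ℝ) (1 / 2), cknD r z₀ p ≤ D) {R : ℝ} (hR : R ∈ Ioc (0 : ℝ) (1 / 2)) :
    eLpNorm (uncurry (R • stPull (R ^ 2) R z₀.1 z₀.2 v)) 3
        (volume.restrict (parabolicCylinder 1 (0 : ℝ × EuclideanSpace ℝ (Fin 3)))) +
      eLpNorm (uncurry (R ^ 2 • stPull (R ^ 2) R z₀.1 z₀.2 p)) (3 / 2)
        (volume.restrict (parabolicCylinder 1 (0 : ℝ × EuclideanSpace ℝ (Fin 3)))) ≤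
      (M : ℝ≥0∞) ^ (1 / 3 : ℝ) + (D : ℝ≥0∞) ^ (2 / 3 : ℝ) := by
  refine add_le_add ?_ ?_
  · rw [eLpNorm_eq_lintegral_rpow_enorm_toReal (by norm_num) (by norm_num)]
    have e : (3 : ℝ≥0∞).toReal = 3 := by norm_num
    rw [e, show (1 / 3 : ℝ) = 1 / 3 from rfl]
    refine ENNReal.rpow_le_rpow ?_ (by norm_num)
    have h1 : ∫⁻ w in parabolicCylinder 1 (0 : ℝ × EuclideanSpace ℝ (Fin 3)),
        ‖(R • stPull (R ^ 2) R z₀.1 z₀.2 v) w.1 w.2‖ₑ ^ (3 : ℕ) ≤ M := by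
      rw [lintegral_cube_zoom hR.1 z₀ v]
      exact hM R hR
    refine le_trans (le_of_eq ?_) h1
    refine lintegral_congr fun w => ?_
    rw [show (3 : ℝ) = ((3 : ℕ) : ℝ) by norm_num, ENNReal.rpow_natCast]
    rfl
  · rw [eLpNorm_eq_lintegral_rpow_enorm_toReal (by norm_num)
      (ENNReal.div_ne_top (by norm_num) (by norm_num))]
    have e : (3 / 2 : ℝ≥0∞).toReal = 3 / 2 := by
      rw [ENNReal.toReal_div]; norm_num
    rw [e, show (1 / (3 / 2) : ℝ) = 2 / 3 by norm_num]
    refine ENNReal.rpow_le_rpow ?_ (by norm_num)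
    have h1 : ∫⁻ w in parabolicCylinder 1 (0 : ℝ × EuclideanSpace ℝ (Fin 3)),
        ‖(R ^ 2 • stPull (R ^ 2) R z₀.1 z₀.2 p) w.1 w.2‖ₑ ^ (3 / 2 : ℝ) ≤ D := by
      rw [lintegral_pressure_zoom hR.1 z₀ p]
      exact hD R hR
    exact h1

end Inputs

/-! ### The extraction at all levels -/

section Levels

variable {v : ℝ → EuclideanSpace ℝ (Fin 3) → EuclideanSpace ℝ (Fin 3)}
  {p : ℝ → EuclideanSpace ℝ (Fin 3) → ℝ}

/-- **The blow-up extraction at all levels, for a general suitable weak solution** (Seregin 2014,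
Prop. 6.20; Seregin–Shilkin 2018, Thm. 3.5; the ESS version is `exists_blowup_levels`). Let
`(v, p)` and `z₀` be such that every rescaled pair `(c v ∘ Φ_c, c² p ∘ Φ_c)`,
`Φ_c(s, y) = (t₀ + c² s, x₀ + c y)`, `0 < c ≤ 1/2`, is a suitable weak solution in the unit ball
(`IsSuitableWeakSolutionInBall 1 0`) and `C(v; z₀, r) ≤ M`, `D(p; z₀, r) ≤ D` for `0 < r ≤ 1/2`.
With the base scales `λₙ = 2^{-(n+2)}` there are a strictly increasing `δ : ℕ → ℕ`, `δ(k) ≥ k`, and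
for every level `m` a pair `(u_m, q_m)`, suitable on every `Q(R)`, `0 < R < 1`, with
`u_m ∈ L³(Q(R))`, such that along `j ↦ δ(j + m)` the rescaled pairs at the scales `2ᵐ λ_{δ(j+m)}`
converge to `(u_m, q_m)`: velocities strongly in `L³(Q(R))`, pressures weakly in `L^{3/2}(Q(R))`.
Proof: verbatim the proof of `exists_blowup_levels` (compactness `SuitableCompactness_holds` at
each level, diagonal lemma `exists_diagonal_subsequence`).
[cite: Seregin2014, §6.6 Prop. 6.20] [cite: Seregin2020, proof of Thm. 2.1 (the rescaling `uᵏ = λₖ v(λₖ y, λₖ² s)`, properties (𝒜))] -/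
theorem exists_zoom_blowup_levels
    {z₀ : ℝ × EuclideanSpace ℝ (Fin 3)}
    (hsuit : ∀ c ∈ Ioc (0 : ℝ) (1 / 2), IsSuitableWeakSolutionInBall 1 0
      (c • stPull (c ^ 2) c z₀.1 z₀.2 v) (c ^ 2 • stPull (c ^ 2) c z₀.1 z₀.2 p))
    {M D : ℝ≥0} (hM : ∀ r ∈ Ioc (0 : ℝ) (1 / 2), cknC r z₀ v ≤ M)
    (hD : ∀ r ∈ Ioc (0 : ℝ) (1 / 2), cknD r z₀ p ≤ D) :
    ∃ δ : ℕ → ℕ, StrictMono δ ∧ (∀ k, k ≤ δ k) ∧ ∀ m : ℕ,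
      ∃ (u : ℝ → EuclideanSpace ℝ (Fin 3) → EuclideanSpace ℝ (Fin 3))
        (q : ℝ → EuclideanSpace ℝ (Fin 3) → ℝ), ∀ R ∈ Ioo (0 : ℝ) 1,
        IsSuitableWeakSolutionInBall R 0 u q ∧
        MemLp (uncurry u) 3
          (volume.restrict (parabolicCylinder R (0 : ℝ × EuclideanSpace ℝ (Fin 3)))) ∧
        Tendsto (fun j => eLpNorm
            (uncurry (((2 : ℝ) ^ m * (1 / 2) ^ (δ (j + m) + 2)) •
                stPull (((2 : ℝ) ^ m * (1 / 2) ^ (δ (j + m) + 2)) ^ 2)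
                  ((2 : ℝ) ^ m * (1 / 2) ^ (δ (j + m) + 2)) z₀.1 z₀.2 v) - uncurry u) 3
            (volume.restrict (parabolicCylinder R (0 : ℝ × EuclideanSpace ℝ (Fin 3)))))
          atTop (𝓝 0) ∧
        ∀ g : ℝ × EuclideanSpace ℝ (Fin 3) → ℝ,
          MemLp g 3 (volume.restrict (parabolicCylinder R (0 : ℝ × EuclideanSpace ℝ (Fin 3)))) →
          Tendsto (fun j => ∫ w in parabolicCylinder R (0 : ℝ × EuclideanSpace ℝ (Fin 3)),
              (((2 : ℝ) ^ m * (1 / 2) ^ (δ (j + m) + 2)) ^ 2 •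
                stPull (((2 : ℝ) ^ m * (1 / 2) ^ (δ (j + m) + 2)) ^ 2)
                  ((2 : ℝ) ^ m * (1 / 2) ^ (δ (j + m) + 2)) z₀.1 z₀.2 p) w.1 w.2 * g w)
            atTop (𝓝 (∫ w in parabolicCylinder R (0 : ℝ × EuclideanSpace ℝ (Fin 3)),
              q w.1 w.2 * g w)) := by
  -- ## abbreviations: scales, zooms, the cylinders' measures, goodness
  set sc : ℕ → ℕ → ℝ := fun m n => (2 : ℝ) ^ m * (1 / 2) ^ (n + 2) with hsc
  set Uz : ℝ → ℝ → EuclideanSpace ℝ (Fin 3) → EuclideanSpace ℝ (Fin 3) :=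
    fun r => r • stPull (r ^ 2) r z₀.1 z₀.2 v with hUz
  set Pz : ℝ → ℝ → EuclideanSpace ℝ (Fin 3) → ℝ :=
    fun r => r ^ 2 • stPull (r ^ 2) r z₀.1 z₀.2 p with hPz
  set μ : ℝ → Measure (ℝ × EuclideanSpace ℝ (Fin 3)) :=
    fun R => volume.restrict (parabolicCylinder R (0 : ℝ × EuclideanSpace ℝ (Fin 3))) with hμ
  set Good : ℕ → (ℕ → ℕ) →
      ((ℝ → EuclideanSpace ℝ (Fin 3) → EuclideanSpace ℝ (Fin 3)) ×
        (ℝ → EuclideanSpace ℝ (Fin 3) → ℝ)) → Prop :=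
    fun m ρ d => ∀ R ∈ Ioo (0 : ℝ) 1,
      IsSuitableWeakSolutionInBall R 0 d.1 d.2 ∧ MemLp (uncurry d.1) 3 (μ R) ∧
      Tendsto (fun j => eLpNorm (uncurry (Uz (sc m (ρ j))) - uncurry d.1) 3 (μ R)) atTop (𝓝 0) ∧
      ∀ g : ℝ × EuclideanSpace ℝ (Fin 3) → ℝ, MemLp g 3 (μ R) →
        Tendsto (fun j => ∫ w in parabolicCylinder R (0 : ℝ × EuclideanSpace ℝ (Fin 3)),
            (Pz (sc m (ρ j))) w.1 w.2 * g w) atTop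
          (𝓝 (∫ w in parabolicCylinder R (0 : ℝ × EuclideanSpace ℝ (Fin 3)), d.2 w.1 w.2 * g w))
    with hGood
  -- ## goodness is stable under subsequences
  have hsub : ∀ (m : ℕ) (ρ : ℕ → ℕ) d (φ : ℕ → ℕ), Good m ρ d → StrictMono φ →
      Good m (ρ ∘ φ) d := by
    intro m ρ d φ hg hφ R hR
    obtain ⟨h1, h2, h3, h4⟩ := hg R hR
    exact ⟨h1, h2, h3.comp hφ.tendsto_atTop, fun g hg' => (h4 g hg').comp hφ.tendsto_atTop⟩
  -- ## extraction at one level (the compactness theorem)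
  have hstep : ∀ (m : ℕ) (τ : ℕ → ℕ), StrictMono τ → (∀ k, m ≤ τ k) →
      ∃ σ : ℕ → ℕ, StrictMono σ ∧ ∃ d, Good m (τ ∘ σ) d := by
    intro m τ hτ hval
    have hscale : ∀ k, sc m (τ k) ∈ Ioc (0 : ℝ) (1 / 2) := fun k =>
      ⟨level_scale_pos m (τ k), level_scale_le_half (hval k)⟩
    have hsuit : ∀ k, IsSuitableWeakSolutionInBall 1 0 (Uz (sc m (τ k))) (Pz (sc m (τ k))) :=
      fun k => hsuit _ (hscale k)
    have hbound : (⨆ k, eLpNorm (uncurry (Uz (sc m (τ k)))) 3 (μ 1) +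
        eLpNorm (uncurry (Pz (sc m (τ k)))) (3 / 2) (μ 1)) < ∞ := by
      refine lt_of_le_of_lt (iSup_le fun k => eLpNorm_zoom_add_le_of hM hD (hscale k)) ?_
      exact ENNReal.add_lt_top.2
        ⟨ENNReal.rpow_lt_top_of_nonneg (by norm_num) ENNReal.coe_ne_top,
          ENNReal.rpow_lt_top_of_nonneg (by norm_num) ENNReal.coe_ne_top⟩
    obtain ⟨u, q, σ, hσ, hconv⟩ :=
      SuitableCompactness_holds (fun k => Uz (sc m (τ k))) (fun k => Pz (sc m (τ k))) hsuit hbound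
    exact ⟨σ, hσ, (u, q), fun R hR => hconv R hR⟩
  -- ## the diagonal
  obtain ⟨δ, hδ, hδge, hgood⟩ := exists_diagonal_subsequence Good hsub hstep
  refine ⟨δ, hδ, hδge, fun m => ?_⟩
  obtain ⟨⟨u, q⟩, hd⟩ := hgood m
  exact ⟨u, q, fun R hR => hd R hR⟩

end Levels

/-! ### The blow-up limit -/

section Limit

variable {v : ℝ → EuclideanSpace ℝ (Fin 3) → EuclideanSpace ℝ (Fin 3)}
  {p : ℝ → EuclideanSpace ℝ (Fin 3) → ℝ}

/-- **The blow-up limit on `ℝ³ × ]-∞, 0[`, for a general suitable weak solution** (Seregin 2014,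
Prop. 6.20, first part; Seregin–Shilkin 2018, Thm. 3.5: the limit of the rescalings is "a local
energy ancient solution"; the ESS version is `exists_blowup_limit`). Under the hypotheses of
`exists_zoom_blowup_levels` there are a strictly increasing `δ` with `δ(k) ≥ k` and a pair `(w, π)`
on `ℝ × ℝ³` such that for every `a > 0`: `(w, π)` is a suitable weak solution on
`Q(a) = ]-a², 0[ × B(a)` (`IsSuitableWeakSolutionInBall a 0 w π`), `w ∈ L³(Q(a))`, and along the
scales `μ_j = 2^{-(δ(j)+2)} → 0` the rescaled velocities `u^{μ_j}(s, y) = μ_j v(t₀ + μ_j² s, x₀ + μ_j y)`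
converge to `w` in `L³(Q(a))` while the rescaled pressures `μ_j² p ∘ Φ_{μ_j}` converge to `π`
weakly in `L^{3/2}(Q(a))`. Proof: verbatim the proof of `exists_blowup_limit` (level limits zoomed
back, uniqueness of strong/weak limits, gluing along `Q(2ᵐ/2)`).
[cite: Seregin2014, §6.6 Prop. 6.20] [cite: Seregin2020, proof of Thm. 2.1, properties (𝒜) (i)] -/
theorem exists_zoom_blowup_limit
    {z₀ : ℝ × EuclideanSpace ℝ (Fin 3)}
    (hv : AEStronglyMeasurable (uncurry v) (volume.restrict (parabolicCylinder (1 / 2) z₀)))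
    (hsuit : ∀ c ∈ Ioc (0 : ℝ) (1 / 2), IsSuitableWeakSolutionInBall 1 0
      (c • stPull (c ^ 2) c z₀.1 z₀.2 v) (c ^ 2 • stPull (c ^ 2) c z₀.1 z₀.2 p))
    {M D : ℝ≥0} (hM : ∀ r ∈ Ioc (0 : ℝ) (1 / 2), cknC r z₀ v ≤ M)
    (hD : ∀ r ∈ Ioc (0 : ℝ) (1 / 2), cknD r z₀ p ≤ D) :
    ∃ (δ : ℕ → ℕ) (w : ℝ → EuclideanSpace ℝ (Fin 3) → EuclideanSpace ℝ (Fin 3))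
      (π : ℝ → EuclideanSpace ℝ (Fin 3) → ℝ), StrictMono δ ∧ (∀ k, k ≤ δ k) ∧
      ∀ a : ℝ, 0 < a →
        IsSuitableWeakSolutionInBall a 0 w π ∧
        MemLp (uncurry w) 3
          (volume.restrict (parabolicCylinder a (0 : ℝ × EuclideanSpace ℝ (Fin 3)))) ∧
        Tendsto (fun j => eLpNorm
            (uncurry (((1 / 2 : ℝ) ^ (δ j + 2)) •
                stPull (((1 / 2 : ℝ) ^ (δ j + 2)) ^ 2) ((1 / 2 : ℝ) ^ (δ j + 2)) z₀.1 z₀.2 v) -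
              uncurry w) 3
            (volume.restrict (parabolicCylinder a (0 : ℝ × EuclideanSpace ℝ (Fin 3)))))
          atTop (𝓝 0) ∧
        ∀ g : ℝ × EuclideanSpace ℝ (Fin 3) → ℝ,
          MemLp g 3 (volume.restrict (parabolicCylinder a (0 : ℝ × EuclideanSpace ℝ (Fin 3)))) →
          Tendsto (fun j => ∫ w' in parabolicCylinder a (0 : ℝ × EuclideanSpace ℝ (Fin 3)),
              ((((1 / 2 : ℝ) ^ (δ j + 2)) ^ 2) •
                stPull (((1 / 2 : ℝ) ^ (δ j + 2)) ^ 2) ((1 / 2 : ℝ) ^ (δ j + 2)) z₀.1 z₀.2 p)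
                  w'.1 w'.2 * g w')
            atTop (𝓝 (∫ w' in parabolicCylinder a (0 : ℝ × EuclideanSpace ℝ (Fin 3)),
              π w'.1 w'.2 * g w')) := by
  classical
  obtain ⟨δ, hδ, hδge, hlev⟩ := exists_zoom_blowup_levels hsuit hM hD
  choose u q hgood using hlev
  -- ## abbreviations
  set lam : ℕ → ℝ := fun n => (1 / 2 : ℝ) ^ (n + 2) with hlam
  set Uz : ℝ → ℝ → EuclideanSpace ℝ (Fin 3) → EuclideanSpace ℝ (Fin 3) :=
    fun r => r • stPull (r ^ 2) r z₀.1 z₀.2 v with hUz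
  set Pz : ℝ → ℝ → EuclideanSpace ℝ (Fin 3) → ℝ :=
    fun r => r ^ 2 • stPull (r ^ 2) r z₀.1 z₀.2 p with hPz
  set cc : ℕ → ℝ := fun m => (2 : ℝ) ^ m with hcc
  have hcc_pos : ∀ m, 0 < cc m := fun m => by positivity
  have hlam_pos : ∀ n, 0 < lam n := fun n => by positivity
  set wl : ℕ → ℝ → EuclideanSpace ℝ (Fin 3) → EuclideanSpace ℝ (Fin 3) :=
    fun m => (cc m)⁻¹ • stPull ((cc m)⁻¹ ^ 2) (cc m)⁻¹ (0 : ℝ) (0 : EuclideanSpace ℝ (Fin 3)) (u m)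
    with hwl
  set πl : ℕ → ℝ → EuclideanSpace ℝ (Fin 3) → ℝ :=
    fun m => (cc m)⁻¹ ^ 2 • stPull ((cc m)⁻¹ ^ 2) (cc m)⁻¹ (0 : ℝ) (0 : EuclideanSpace ℝ (Fin 3)) (q m)
    with hπl
  -- ## the zoom relations
  have hUz_level : ∀ m n, Uz (cc m * lam n) =
      cc m • stPull (cc m ^ 2) (cc m) (0 : ℝ) (0 : EuclideanSpace ℝ (Fin 3)) (Uz (lam n)) := by
    intro m n
    show (cc m * lam n) • stPull ((cc m * lam n) ^ 2) (cc m * lam n) z₀.1 z₀.2 v = _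
    rw [zoom_zoom]
  have hPz_level : ∀ m n, Pz (cc m * lam n) =
      cc m ^ 2 • stPull (cc m ^ 2) (cc m) (0 : ℝ) (0 : EuclideanSpace ℝ (Fin 3)) (Pz (lam n)) := by
    intro m n
    show (cc m * lam n) ^ 2 • stPull ((cc m * lam n) ^ 2) (cc m * lam n) z₀.1 z₀.2 p = _
    rw [zoom_zoom, mul_pow]
  have hu_wl : ∀ m, u m = cc m • stPull (cc m ^ 2) (cc m) (0 : ℝ) (0 : EuclideanSpace ℝ (Fin 3)) (wl m) :=
    fun m => (zoom_zoom_origin_inv (hcc_pos m).ne' _ _ (mul_inv_cancel₀ (hcc_pos m).ne') (u m)).symm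
  have hq_πl : ∀ m, q m =
      cc m ^ 2 • stPull (cc m ^ 2) (cc m) (0 : ℝ) (0 : EuclideanSpace ℝ (Fin 3)) (πl m) :=
    fun m => (zoom_zoom_origin_inv (hcc_pos m).ne' _ _
      (by rw [← mul_pow, mul_inv_cancel₀ (hcc_pos m).ne', one_pow]) (q m)).symm
  -- the cylinders of level `m`
  have hcyl : ∀ m (R : ℝ), parabolicCylinder R (0 : ℝ × EuclideanSpace ℝ (Fin 3)) =
      parabolicCylinder ((cc m * R) / cc m) (0 : ℝ × EuclideanSpace ℝ (Fin 3)) := by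
    intro m R; rw [mul_div_cancel_left₀ R (hcc_pos m).ne']
  have hcyl' : ∀ m (R : ℝ), parabolicCylinder (R / (cc m)⁻¹) (0 : ℝ × EuclideanSpace ℝ (Fin 3)) =
      parabolicCylinder (cc m * R) (0 : ℝ × EuclideanSpace ℝ (Fin 3)) := by
    intro m R; rw [div_inv_eq_mul, mul_comm]
  -- ## (A) strong convergence at level `m`, in the base scale, on `Q(2ᵐ R)`
  have hbase : ∀ m, ∀ R ∈ Ioo (0 : ℝ) 1,
      Tendsto (fun j => eLpNorm (uncurry (Uz (lam (δ (j + m)))) - uncurry (wl m)) 3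
        (volume.restrict (parabolicCylinder (cc m * R) (0 : ℝ × EuclideanSpace ℝ (Fin 3)))))
        atTop (𝓝 0) := by
    intro m R hR
    obtain ⟨-, -, h3, -⟩ := hgood m R hR
    have h3' : Tendsto (fun j => eLpNorm (uncurry (Uz (cc m * lam (δ (j + m)))) - uncurry (u m)) 3
        (volume.restrict (parabolicCylinder R (0 : ℝ × EuclideanSpace ℝ (Fin 3))))) atTop (𝓝 0) :=
      h3
    set K : ℝ≥0∞ := ‖cc m‖ₑ * (ENNReal.ofReal (cc m ^ 2 * cc m ^ 3)⁻¹) ^ (1 / (3 : ℝ≥0∞).toReal)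
      with hK
    have key : ∀ j, eLpNorm (uncurry (Uz (cc m * lam (δ (j + m)))) - uncurry (u m)) 3
        (volume.restrict (parabolicCylinder R (0 : ℝ × EuclideanSpace ℝ (Fin 3)))) =
        K * eLpNorm (uncurry (Uz (lam (δ (j + m)))) - uncurry (wl m)) 3
          (volume.restrict (parabolicCylinder (cc m * R) (0 : ℝ × EuclideanSpace ℝ (Fin 3)))) := by
      intro j
      rw [hUz_level, hu_wl m]
      have e1 : uncurry (cc m • stPull (cc m ^ 2) (cc m) (0 : ℝ) (0 : EuclideanSpace ℝ (Fin 3))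
            (Uz (lam (δ (j + m))))) -
          uncurry (cc m • stPull (cc m ^ 2) (cc m) (0 : ℝ) (0 : EuclideanSpace ℝ (Fin 3)) (wl m)) =
          uncurry (cc m • stPull (cc m ^ 2) (cc m) (0 : ℝ) (0 : EuclideanSpace ℝ (Fin 3))
            (Uz (lam (δ (j + m))) - wl m)) := by
        funext z
        show _ - _ = cc m • (Uz (lam (δ (j + m))) - wl m) _ _
        rw [Pi.sub_apply, Pi.sub_apply, smul_sub]
        rfl
      rw [e1, hcyl m R, eLpNorm_uncurry_zoom (hcc_pos m) (cc m) _ (cc m * R) (by norm_num)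
        (by norm_num)]
      rfl
    have hK0 : K ≠ 0 := by
      refine mul_ne_zero ?_ ?_
      · rw [Real.enorm_eq_ofReal (hcc_pos m).le]; exact (ENNReal.ofReal_pos.2 (hcc_pos m)).ne'
      · exact (ENNReal.rpow_pos (ENNReal.ofReal_pos.2 (by positivity)) ENNReal.ofReal_ne_top).ne'
    have hKtop : K ≠ ⊤ :=
      ENNReal.mul_ne_top enorm_ne_top (ENNReal.rpow_ne_top_of_nonneg (by positivity) ENNReal.ofReal_ne_top)
    simp only [key] at h3'
    have h4 := ENNReal.Tendsto.const_mul h3' (Or.inr (ENNReal.inv_ne_top.2 hK0)) (a := K⁻¹)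
    simp only [mul_zero, ← mul_assoc, ENNReal.inv_mul_cancel hK0 hKtop, one_mul] at h4
    exact h4
  -- the same along the unshifted sequence
  have hbase' : ∀ m, ∀ R ∈ Ioo (0 : ℝ) 1,
      Tendsto (fun j => eLpNorm (uncurry (Uz (lam (δ j))) - uncurry (wl m)) 3
        (volume.restrict (parabolicCylinder (cc m * R) (0 : ℝ × EuclideanSpace ℝ (Fin 3)))))
        atTop (𝓝 0) := fun m R hR =>
    (tendsto_add_atTop_iff_nat (f := fun j => eLpNorm (uncurry (Uz (lam (δ j))) - uncurry (wl m)) 3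
      (volume.restrict (parabolicCylinder (cc m * R) (0 : ℝ × EuclideanSpace ℝ (Fin 3))))) m).1
      (hbase m R hR)
  -- ## (B) weak convergence of the pressures at level `m`, in the base scale, on `Q(2ᵐ R)`
  have hweak : ∀ m, ∀ R ∈ Ioo (0 : ℝ) 1, ∀ g : ℝ × EuclideanSpace ℝ (Fin 3) → ℝ,
      MemLp g 3 (volume.restrict (parabolicCylinder (cc m * R) (0 : ℝ × EuclideanSpace ℝ (Fin 3)))) →
      Tendsto (fun j => ∫ w in parabolicCylinder (cc m * R) (0 : ℝ × EuclideanSpace ℝ (Fin 3)),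
          (Pz (lam (δ (j + m)))) w.1 w.2 * g w) atTop
        (𝓝 (∫ w in parabolicCylinder (cc m * R) (0 : ℝ × EuclideanSpace ℝ (Fin 3)),
          (πl m) w.1 w.2 * g w)) := by
    intro m R hR g hg
    obtain ⟨-, -, -, h4⟩ := hgood m R hR
    have hg' : MemLp (g ∘ stAffine (cc m ^ 2) (cc m) (0 : ℝ) (0 : EuclideanSpace ℝ (Fin 3))) 3
        (volume.restrict (parabolicCylinder R (0 : ℝ × EuclideanSpace ℝ (Fin 3)))) := by
      rw [hcyl m R]
      exact memLp_comp_zoom (hcc_pos m) (by norm_num) (by norm_num) hg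
    have h5 : Tendsto (fun j => ∫ w in parabolicCylinder R (0 : ℝ × EuclideanSpace ℝ (Fin 3)),
        (Pz (cc m * lam (δ (j + m)))) w.1 w.2 *
          (g ∘ stAffine (cc m ^ 2) (cc m) (0 : ℝ) (0 : EuclideanSpace ℝ (Fin 3))) w) atTop
        (𝓝 (∫ w in parabolicCylinder R (0 : ℝ × EuclideanSpace ℝ (Fin 3)),
          (q m) w.1 w.2 * (g ∘ stAffine (cc m ^ 2) (cc m) (0 : ℝ) (0 : EuclideanSpace ℝ (Fin 3))) w)) :=
      h4 _ hg'
    set K : ℝ := cc m ^ 2 * (cc m ^ 2 * cc m ^ 3)⁻¹ with hK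
    have hK0 : K ≠ 0 := by positivity
    have key : ∀ ρ : ℝ → EuclideanSpace ℝ (Fin 3) → ℝ,
        ∫ w in parabolicCylinder R (0 : ℝ × EuclideanSpace ℝ (Fin 3)),
          (cc m ^ 2 • stPull (cc m ^ 2) (cc m) (0 : ℝ) (0 : EuclideanSpace ℝ (Fin 3)) ρ) w.1 w.2 *
            (g ∘ stAffine (cc m ^ 2) (cc m) (0 : ℝ) (0 : EuclideanSpace ℝ (Fin 3))) w =
          K * ∫ w in parabolicCylinder (cc m * R) (0 : ℝ × EuclideanSpace ℝ (Fin 3)),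
            ρ w.1 w.2 * g w := by
      intro ρ
      rw [hcyl m R]
      exact setIntegral_zoom_pressure_mul (hcc_pos m) _ ρ g (cc m * R)
    simp only [hPz_level, hq_πl m, key] at h5
    have h6 := h5.const_mul K⁻¹
    simp only [← mul_assoc, inv_mul_cancel₀ hK0, one_mul] at h6
    exact h6
  have hweak' : ∀ m, ∀ R ∈ Ioo (0 : ℝ) 1, ∀ g : ℝ × EuclideanSpace ℝ (Fin 3) → ℝ,
      MemLp g 3 (volume.restrict (parabolicCylinder (cc m * R) (0 : ℝ × EuclideanSpace ℝ (Fin 3)))) →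
      Tendsto (fun j => ∫ w in parabolicCylinder (cc m * R) (0 : ℝ × EuclideanSpace ℝ (Fin 3)),
          (Pz (lam (δ j))) w.1 w.2 * g w) atTop
        (𝓝 (∫ w in parabolicCylinder (cc m * R) (0 : ℝ × EuclideanSpace ℝ (Fin 3)),
          (πl m) w.1 w.2 * g w)) := fun m R hR g hg =>
    (tendsto_add_atTop_iff_nat (f := fun j => ∫ w in parabolicCylinder (cc m * R)
      (0 : ℝ × EuclideanSpace ℝ (Fin 3)), (Pz (lam (δ j))) w.1 w.2 * g w) m).1 (hweak m R hR g hg)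
  -- ## measurability and integrability
  have hUz_meas : ∀ a : ℝ, 0 < a → ∃ j₀ : ℕ, ∀ j, j₀ ≤ j →
      AEStronglyMeasurable (uncurry (Uz (lam (δ j))))
        (volume.restrict (parabolicCylinder a (0 : ℝ × EuclideanSpace ℝ (Fin 3)))) := by
    intro a ha
    have ht : Tendsto (fun n : ℕ => a * (1 / 2 : ℝ) ^ (n + 2)) atTop (𝓝 (a * 0)) :=
      ((tendsto_pow_atTop_nhds_zero_of_lt_one (by norm_num) (by norm_num)).comp
        (tendsto_add_atTop_nat 2)).const_mul a
    rw [mul_zero] at ht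
    obtain ⟨j₀, hj₀⟩ := (ht.eventually (gt_mem_nhds (by norm_num : (0 : ℝ) < 1 / 2))).exists_forall_of_atTop
    refine ⟨j₀, fun j hj => ?_⟩
    refine aestronglyMeasurable_uncurry_zoom_of hv (hlam_pos _) ha ?_
    have h1 : (1 / 2 : ℝ) ^ (δ j + 2) ≤ (1 / 2) ^ (j₀ + 2) :=
      pow_le_pow_of_le_one (by norm_num) (by norm_num) (by have := hδge j; omega)
    have h2 := hj₀ j₀ le_rfl
    show a * (1 / 2 : ℝ) ^ (δ j + 2) ≤ 1 / 2
    nlinarith [pow_nonneg (by norm_num : (0 : ℝ) ≤ 1 / 2) (δ j + 2)]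
  have hwl_memLp : ∀ m, ∀ R ∈ Ioo (0 : ℝ) 1, MemLp (uncurry (wl m)) 3
      (volume.restrict (parabolicCylinder (cc m * R) (0 : ℝ × EuclideanSpace ℝ (Fin 3)))) := by
    intro m R hR
    obtain ⟨-, h2, -, -⟩ := hgood m R hR
    have h1 := (memLp_comp_zoom (inv_pos.2 (hcc_pos m)) (by norm_num) (by norm_num) h2).const_smul
      (cc m)⁻¹
    rw [hcyl'] at h1
    exact h1
  have hπl_memLp : ∀ m, ∀ R ∈ Ioo (0 : ℝ) 1, MemLp (uncurry (πl m)) (3 / 2)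
      (volume.restrict (parabolicCylinder (cc m * R) (0 : ℝ × EuclideanSpace ℝ (Fin 3)))) := by
    intro m R hR
    obtain ⟨h1, -, -, -⟩ := hgood m R hR
    have h2 := (memLp_comp_zoom (inv_pos.2 (hcc_pos m)) (by norm_num)
      (ENNReal.div_ne_top (by norm_num) (by norm_num)) h1.2.2.2).const_smul ((cc m)⁻¹ ^ 2)
    rw [hcyl'] at h2
    exact h2
  -- ## (C) consecutive levels agree a.e.
  have hstep_cyl : ∀ m (R : ℝ), cc (m + 1) * (R / 2) = cc m * R := by
    intro m R; show (2 : ℝ) ^ (m + 1) * (R / 2) = 2 ^ m * R; rw [pow_succ]; ring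
  have hcons_w : ∀ m, ∀ R ∈ Ioo (0 : ℝ) 1,
      ∀ᵐ z ∂(volume.restrict (parabolicCylinder (cc m * R) (0 : ℝ × EuclideanSpace ℝ (Fin 3)))),
        uncurry (wl m) z = uncurry (wl (m + 1)) z := by
    intro m R hR
    have hR2 : R / 2 ∈ Ioo (0 : ℝ) 1 := ⟨by linarith [hR.1], by linarith [hR.2]⟩
    have h1 := hbase' m R hR
    have h2 := hbase' (m + 1) (R / 2) hR2
    have hm2 := hwl_memLp (m + 1) (R / 2) hR2
    rw [hstep_cyl] at h2 hm2
    obtain ⟨j₀, hj₀⟩ := hUz_meas (cc m * R) (by have := hcc_pos m; have := hR.1; positivity)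
    have h1' := (tendsto_add_atTop_iff_nat (f := fun j => eLpNorm (uncurry (Uz (lam (δ j))) -
      uncurry (wl m)) 3 (volume.restrict (parabolicCylinder (cc m * R)
        (0 : ℝ × EuclideanSpace ℝ (Fin 3))))) j₀).2 h1
    have h2' := (tendsto_add_atTop_iff_nat (f := fun j => eLpNorm (uncurry (Uz (lam (δ j))) -
      uncurry (wl (m + 1))) 3 (volume.restrict (parabolicCylinder (cc m * R)
        (0 : ℝ × EuclideanSpace ℝ (Fin 3))))) j₀).2 h2
    exact ae_eq_of_tendsto_eLpNorm_sub (by norm_num) (fun j => hj₀ (j + j₀) (Nat.le_add_left _ _))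
      (hwl_memLp m R hR).1 hm2.1 h1' h2'
  have hcons_π : ∀ m, ∀ R ∈ Ioo (0 : ℝ) 1,
      ∀ᵐ z ∂(volume.restrict (parabolicCylinder (cc m * R) (0 : ℝ × EuclideanSpace ℝ (Fin 3)))),
        uncurry (πl m) z = uncurry (πl (m + 1)) z := by
    intro m R hR
    have hR2 : R / 2 ∈ Ioo (0 : ℝ) 1 := ⟨by linarith [hR.1], by linarith [hR.2]⟩
    have hm2 := hπl_memLp (m + 1) (R / 2) hR2
    rw [hstep_cyl] at hm2
    refine ae_eq_of_forall_setIntegral_mul_eq (hπl_memLp m R hR) hm2 fun g hg => ?_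
    have h1 := hweak m R hR g hg
    have h2 := hweak (m + 1) (R / 2) hR2 g (by rw [hstep_cyl]; exact hg)
    rw [hstep_cyl] at h2
    -- align the shifts: `j + 1 + m = j + (m + 1)`
    have h1' := (tendsto_add_atTop_iff_nat (f := fun j => ∫ w in parabolicCylinder (cc m * R)
      (0 : ℝ × EuclideanSpace ℝ (Fin 3)), (Pz (lam (δ (j + m)))) w.1 w.2 * g w) 1).2 h1
    have e : (fun j => (fun j => ∫ w in parabolicCylinder (cc m * R)
        (0 : ℝ × EuclideanSpace ℝ (Fin 3)), (Pz (lam (δ (j + m)))) w.1 w.2 * g w) (j + 1)) =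
        fun j => ∫ w in parabolicCylinder (cc m * R) (0 : ℝ × EuclideanSpace ℝ (Fin 3)),
          (Pz (lam (δ (j + (m + 1))))) w.1 w.2 * g w := by
      funext j
      show ∫ w in parabolicCylinder (cc m * R) (0 : ℝ × EuclideanSpace ℝ (Fin 3)),
          (Pz (lam (δ (j + 1 + m)))) w.1 w.2 * g w = _
      rw [show j + 1 + m = j + (m + 1) by ring]
    rw [e] at h1'
    exact tendsto_nhds_unique h1' h2
  -- iterated consistency
  have hcons_w' : ∀ n m, n ≤ m → ∀ R ∈ Ioo (0 : ℝ) 1,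
      ∀ᵐ z ∂(volume.restrict (parabolicCylinder (cc n * R) (0 : ℝ × EuclideanSpace ℝ (Fin 3)))),
        uncurry (wl n) z = uncurry (wl m) z := by
    intro n m hnm R hR
    induction m, hnm using Nat.le_induction with
    | base => exact ae_of_all _ fun z => rfl
    | succ m hnm ih =>
        have hsub : parabolicCylinder (cc n * R) (0 : ℝ × EuclideanSpace ℝ (Fin 3)) ⊆
            parabolicCylinder (cc m * R) (0 : ℝ × EuclideanSpace ℝ (Fin 3)) :=
          parabolicCylinder_mono (by have := hcc_pos n; have := hR.1; positivity)
            (mul_le_mul_of_nonneg_right (pow_le_pow_right₀ (by norm_num) hnm) hR.1.le) _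
        filter_upwards [ih, ae_restrict_of_ae_restrict_of_subset hsub (hcons_w m R hR)] with z h1 h2
        rw [h1, h2]
  have hcons_π' : ∀ n m, n ≤ m → ∀ R ∈ Ioo (0 : ℝ) 1,
      ∀ᵐ z ∂(volume.restrict (parabolicCylinder (cc n * R) (0 : ℝ × EuclideanSpace ℝ (Fin 3)))),
        uncurry (πl n) z = uncurry (πl m) z := by
    intro n m hnm R hR
    induction m, hnm using Nat.le_induction with
    | base => exact ae_of_all _ fun z => rfl
    | succ m hnm ih =>
        have hsub : parabolicCylinder (cc n * R) (0 : ℝ × EuclideanSpace ℝ (Fin 3)) ⊆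
            parabolicCylinder (cc m * R) (0 : ℝ × EuclideanSpace ℝ (Fin 3)) :=
          parabolicCylinder_mono (by have := hcc_pos n; have := hR.1; positivity)
            (mul_le_mul_of_nonneg_right (pow_le_pow_right₀ (by norm_num) hnm) hR.1.le) _
        filter_upwards [ih, ae_restrict_of_ae_restrict_of_subset hsub (hcons_π m R hR)] with z h1 h2
        rw [h1, h2]
  -- ## (D) gluing along the exhaustion `Q(2ᵐ / 2)`
  set w : ℝ → EuclideanSpace ℝ (Fin 3) → EuclideanSpace ℝ (Fin 3) := fun s y =>
    if hz : ∃ m : ℕ, ((s, y) : ℝ × EuclideanSpace ℝ (Fin 3)) ∈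
        parabolicCylinder (cc m / 2) (0 : ℝ × EuclideanSpace ℝ (Fin 3))
    then wl (Nat.find hz) s y else 0 with hw
  set π : ℝ → EuclideanSpace ℝ (Fin 3) → ℝ := fun s y =>
    if hz : ∃ m : ℕ, ((s, y) : ℝ × EuclideanSpace ℝ (Fin 3)) ∈
        parabolicCylinder (cc m / 2) (0 : ℝ × EuclideanSpace ℝ (Fin 3))
    then πl (Nat.find hz) s y else 0 with hπ
  have hhalf : ∀ m, cc m * (1 / 2) = cc m / 2 := fun m => by ring
  have hw_ae : ∀ m, ∀ᵐ z ∂(volume.restrict (parabolicCylinder (cc m / 2)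
      (0 : ℝ × EuclideanSpace ℝ (Fin 3)))), uncurry w z = uncurry (wl m) z := by
    intro m
    have hall : ∀ n, n ≤ m → ∀ᵐ z ∂(volume.restrict (parabolicCylinder (cc m / 2)
        (0 : ℝ × EuclideanSpace ℝ (Fin 3)))),
        z ∈ parabolicCylinder (cc n / 2) (0 : ℝ × EuclideanSpace ℝ (Fin 3)) →
          uncurry (wl n) z = uncurry (wl m) z := by
      intro n hn
      have h1 := hcons_w' n m hn (1 / 2) (by norm_num)
      rw [hhalf] at h1
      rw [ae_restrict_iff' (isOpen_parabolicCylinder _ _).measurableSet] at h1 ⊢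
      filter_upwards [h1] with z hz _ hzn
      exact hz hzn
    have hall' : ∀ᵐ z ∂(volume.restrict (parabolicCylinder (cc m / 2)
        (0 : ℝ × EuclideanSpace ℝ (Fin 3)))), ∀ n ∈ Finset.range (m + 1),
        z ∈ parabolicCylinder (cc n / 2) (0 : ℝ × EuclideanSpace ℝ (Fin 3)) →
          uncurry (wl n) z = uncurry (wl m) z :=
      (Finset.range (m + 1)).eventually_all.2 fun n hn =>
        hall n (Nat.lt_succ_iff.1 (Finset.mem_range.1 hn))
    filter_upwards [hall', ae_restrict_mem (isOpen_parabolicCylinder _ _).measurableSet] with z hz hzm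
    have hex : ∃ n : ℕ, z ∈ parabolicCylinder (cc n / 2) (0 : ℝ × EuclideanSpace ℝ (Fin 3)) :=
      ⟨m, hzm⟩
    have hN : Nat.find hex ≤ m := Nat.find_min' hex hzm
    have hzN := Nat.find_spec hex
    have e : uncurry w z = uncurry (wl (Nat.find hex)) z := by
      rcases z with ⟨s, y⟩
      show (if hz : ∃ m : ℕ, ((s, y) : ℝ × EuclideanSpace ℝ (Fin 3)) ∈
          parabolicCylinder (cc m / 2) (0 : ℝ × EuclideanSpace ℝ (Fin 3))
        then wl (Nat.find hz) s y else 0) = wl (Nat.find hex) s y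
      rw [dif_pos hex]
    rw [e]
    exact hz (Nat.find hex) (Finset.mem_range.2 (Nat.lt_succ_of_le hN)) hzN
  have hπ_ae : ∀ m, ∀ᵐ z ∂(volume.restrict (parabolicCylinder (cc m / 2)
      (0 : ℝ × EuclideanSpace ℝ (Fin 3)))), uncurry π z = uncurry (πl m) z := by
    intro m
    have hall : ∀ n, n ≤ m → ∀ᵐ z ∂(volume.restrict (parabolicCylinder (cc m / 2)
        (0 : ℝ × EuclideanSpace ℝ (Fin 3)))),
        z ∈ parabolicCylinder (cc n / 2) (0 : ℝ × EuclideanSpace ℝ (Fin 3)) →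
          uncurry (πl n) z = uncurry (πl m) z := by
      intro n hn
      have h1 := hcons_π' n m hn (1 / 2) (by norm_num)
      rw [hhalf] at h1
      rw [ae_restrict_iff' (isOpen_parabolicCylinder _ _).measurableSet] at h1 ⊢
      filter_upwards [h1] with z hz _ hzn
      exact hz hzn
    have hall' : ∀ᵐ z ∂(volume.restrict (parabolicCylinder (cc m / 2)
        (0 : ℝ × EuclideanSpace ℝ (Fin 3)))), ∀ n ∈ Finset.range (m + 1),
        z ∈ parabolicCylinder (cc n / 2) (0 : ℝ × EuclideanSpace ℝ (Fin 3)) →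
          uncurry (πl n) z = uncurry (πl m) z :=
      (Finset.range (m + 1)).eventually_all.2 fun n hn =>
        hall n (Nat.lt_succ_iff.1 (Finset.mem_range.1 hn))
    filter_upwards [hall', ae_restrict_mem (isOpen_parabolicCylinder _ _).measurableSet] with z hz hzm
    have hex : ∃ n : ℕ, z ∈ parabolicCylinder (cc n / 2) (0 : ℝ × EuclideanSpace ℝ (Fin 3)) :=
      ⟨m, hzm⟩
    have hN : Nat.find hex ≤ m := Nat.find_min' hex hzm
    have hzN := Nat.find_spec hex
    have e : uncurry π z = uncurry (πl (Nat.find hex)) z := by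
      rcases z with ⟨s, y⟩
      show (if hz : ∃ m : ℕ, ((s, y) : ℝ × EuclideanSpace ℝ (Fin 3)) ∈
          parabolicCylinder (cc m / 2) (0 : ℝ × EuclideanSpace ℝ (Fin 3))
        then πl (Nat.find hz) s y else 0) = πl (Nat.find hex) s y
      rw [dif_pos hex]
    rw [e]
    exact hz (Nat.find hex) (Finset.mem_range.2 (Nat.lt_succ_of_le hN)) hzN
  -- ## the conclusion on an arbitrary cylinder `Q(a)`
  refine ⟨δ, w, π, hδ, hδge, fun a ha => ?_⟩
  obtain ⟨m, hm⟩ := pow_unbounded_of_one_lt (2 * a) (by norm_num : (1 : ℝ) < 2)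
  have hm' : a < cc m / 2 := by show a < 2 ^ m / 2; linarith
  set R : ℝ := a / cc m with hRdef
  have hR : R ∈ Ioo (0 : ℝ) 1 := by
    refine ⟨div_pos ha (hcc_pos m), ?_⟩
    rw [hRdef, div_lt_one (hcc_pos m)]
    linarith [hcc_pos m]
  have hcR : cc m * R = a := by rw [hRdef, mul_div_cancel₀ a (hcc_pos m).ne']
  have hsubQ : parabolicCylinder a (0 : ℝ × EuclideanSpace ℝ (Fin 3)) ⊆
      parabolicCylinder (cc m / 2) (0 : ℝ × EuclideanSpace ℝ (Fin 3)) :=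
    parabolicCylinder_mono ha.le hm'.le _
  have hw_a : ∀ᵐ z ∂(volume.restrict (parabolicCylinder a (0 : ℝ × EuclideanSpace ℝ (Fin 3)))),
      uncurry (wl m) z = uncurry w z := by
    filter_upwards [ae_restrict_of_ae_restrict_of_subset hsubQ (hw_ae m)] with z hz
    exact hz.symm
  have hπ_a : ∀ᵐ z ∂(volume.restrict (parabolicCylinder a (0 : ℝ × EuclideanSpace ℝ (Fin 3)))),
      uncurry (πl m) z = uncurry π z := by
    filter_upwards [ae_restrict_of_ae_restrict_of_subset hsubQ (hπ_ae m)] with z hz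
    exact hz.symm
  obtain ⟨h1, -, -, -⟩ := hgood m R hR
  refine ⟨?_, ?_, ?_, ?_⟩
  · -- suitability
    have h2 := h1.zoomOut (inv_pos.2 (hcc_pos m))
    have e : R / (cc m)⁻¹ = a := by rw [div_inv_eq_mul, mul_comm, hcR]
    rw [e] at h2
    exact h2.congr_ae' hw_a hπ_a
  · -- `w ∈ L³(Q(a))`
    have h2 := hwl_memLp m R hR
    rw [hcR] at h2
    exact h2.ae_eq hw_a
  · -- strong convergence of the velocities
    have h2 := hbase' m R hR
    rw [hcR] at h2
    refine (tendsto_congr fun j => ?_).1 h2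
    refine eLpNorm_congr_ae ?_
    filter_upwards [hw_a] with z hz
    show uncurry (Uz (lam (δ j))) z - uncurry (wl m) z = uncurry (Uz (lam (δ j))) z - uncurry w z
    rw [hz]
  · -- weak convergence of the pressures
    intro g hg
    have hg' : MemLp g 3 (volume.restrict (parabolicCylinder (cc m * R)
        (0 : ℝ × EuclideanSpace ℝ (Fin 3)))) := by rw [hcR]; exact hg
    have h2 := hweak' m R hR g hg'
    rw [hcR] at h2
    have e : ∫ w' in parabolicCylinder a (0 : ℝ × EuclideanSpace ℝ (Fin 3)), (πl m) w'.1 w'.2 * g w' =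
        ∫ w' in parabolicCylinder a (0 : ℝ × EuclideanSpace ℝ (Fin 3)), π w'.1 w'.2 * g w' := by
      refine integral_congr_ae ?_
      filter_upwards [hπ_a] with z hz
      change (πl m) z.1 z.2 = π z.1 z.2 at hz
      rw [hz]
    rw [e] at h2
    exact h2

end Limit

/-! ### Properties of the limit: non-triviality and the pressure bound -/

section Properties

variable {v : ℝ → EuclideanSpace ℝ (Fin 3) → EuclideanSpace ℝ (Fin 3)}
  {p : ℝ → EuclideanSpace ℝ (Fin 3) → ℝ}

/-- **Non-triviality of the blow-up limit** (Seregin 2014, (6.6.1); ESS 2003, §3 (3.16); the ESS-class version is `blowup_lintegral_cube_ge`): at a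
point `z₀` with `C(ρ; z₀) ≥ η` for all `0 < ρ ≤ 1/2`, a strong `L³(Q(a))` limit `w` of the
rescaled velocities `u^{μ_j}`, `μ_j = 2^{-(δ(j)+2)}`, `δ(j) ≥ j`, satisfies
`∫_{Q(a)} |w|³ ≥ η a²`. [cite: Seregin2014, §6.6 Prop. 6.20 (6.6.1)] [cite: EscauriazaSereginSverak2003, §3 (3.16)] -/
theorem blowup_lintegral_cube_ge_of
    {z₀ : ℝ × EuclideanSpace ℝ (Fin 3)}
    (hv : AEStronglyMeasurable (uncurry v) (volume.restrict (parabolicCylinder (1 / 2) z₀)))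
    {δ : ℕ → ℕ} (hδge : ∀ k, k ≤ δ k)
    {w : ℝ → EuclideanSpace ℝ (Fin 3) → EuclideanSpace ℝ (Fin 3)} {η a : ℝ}
    (hη : ∀ ρ ∈ Ioc (0 : ℝ) (1 / 2), ENNReal.ofReal η ≤ cknC ρ z₀ v) (ha : 0 < a)
    (hw : AEStronglyMeasurable (uncurry w)
      (volume.restrict (parabolicCylinder a (0 : ℝ × EuclideanSpace ℝ (Fin 3)))))
    (hconv : Tendsto (fun j => eLpNorm
        (uncurry (((1 / 2 : ℝ) ^ (δ j + 2)) •
            stPull (((1 / 2 : ℝ) ^ (δ j + 2)) ^ 2) ((1 / 2 : ℝ) ^ (δ j + 2)) z₀.1 z₀.2 v) -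
          uncurry w) 3
        (volume.restrict (parabolicCylinder a (0 : ℝ × EuclideanSpace ℝ (Fin 3)))))
      atTop (𝓝 0)) :
    ENNReal.ofReal (a ^ 2 * η) ≤
      ∫⁻ z in parabolicCylinder a (0 : ℝ × EuclideanSpace ℝ (Fin 3)), ‖w z.1 z.2‖ₑ ^ (3 : ℕ) := by
  set lam : ℕ → ℝ := fun n => (1 / 2 : ℝ) ^ (n + 2) with hlam
  set U : ℕ → ℝ → EuclideanSpace ℝ (Fin 3) → EuclideanSpace ℝ (Fin 3) :=
    fun j => (lam (δ j)) • stPull ((lam (δ j)) ^ 2) (lam (δ j)) z₀.1 z₀.2 v with hU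
  set μ' : Measure (ℝ × EuclideanSpace ℝ (Fin 3)) :=
    volume.restrict (parabolicCylinder a (0 : ℝ × EuclideanSpace ℝ (Fin 3))) with hμ'
  have hlam_pos : ∀ n, 0 < lam n := fun n => by positivity
  obtain ⟨j₀, hj₀⟩ := eventually_scale_mul_le_half hδge ha
  -- the lower bound and the measurability of the approximants, for `j ≥ j₀`
  have hlow : ∀ j, j₀ ≤ j → ENNReal.ofReal (a ^ 2 * η) ≤ ∫⁻ z, ‖uncurry (U j) z‖ₑ ^ (3 : ℕ) ∂μ' :=
    fun j hj => ofReal_sq_mul_eta_le_lintegral_cube_zoom hη (hlam_pos _) ha (hj₀ j hj)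
  have hmeas : ∀ j, j₀ ≤ j → AEStronglyMeasurable (uncurry (U j)) μ' :=
    fun j hj => aestronglyMeasurable_uncurry_zoom_of hv (hlam_pos _) ha (hj₀ j hj)
  have hconv' : Tendsto (fun j => eLpNorm (uncurry (U j) - uncurry w) 3 μ') atTop (𝓝 0) := hconv
  -- `b = (a² η)^{1/3} ≤ ‖U_j‖₃ ≤ ‖w‖₃ + ‖U_j - w‖₃`
  set b : ℝ≥0∞ := (ENNReal.ofReal (a ^ 2 * η)) ^ (1 / 3 : ℝ) with hb
  have hble : ∀ j, j₀ ≤ j → b ≤ eLpNorm (uncurry w) 3 μ' + eLpNorm (uncurry (U j) - uncurry w) 3 μ' := by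
    intro j hj
    have h1 : b ≤ eLpNorm (uncurry (U j)) 3 μ' := by
      rw [hb, eLpNorm_three_eq_lintegral_cube_rpow]
      exact ENNReal.rpow_le_rpow (hlow j hj) (by norm_num)
    refine h1.trans ?_
    have e : uncurry (U j) = uncurry w + (uncurry (U j) - uncurry w) := by abel
    calc eLpNorm (uncurry (U j)) 3 μ' = eLpNorm (uncurry w + (uncurry (U j) - uncurry w)) 3 μ' := by
          rw [← e]
      _ ≤ eLpNorm (uncurry w) 3 μ' + eLpNorm (uncurry (U j) - uncurry w) 3 μ' :=
          eLpNorm_add_le hw ((hmeas j hj).sub hw) (by norm_num)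
  have hlim : Tendsto (fun j => eLpNorm (uncurry w) 3 μ' + eLpNorm (uncurry (U j) - uncurry w) 3 μ')
      atTop (𝓝 (eLpNorm (uncurry w) 3 μ')) := by
    have := (tendsto_const_nhds (x := eLpNorm (uncurry w) 3 μ') (f := (atTop : Filter ℕ))).add hconv'
    rwa [add_zero] at this
  have hb_le : b ≤ eLpNorm (uncurry w) 3 μ' :=
    ge_of_tendsto hlim (eventually_atTop.2 ⟨j₀, fun j hj => hble j hj⟩)
  have h3 := ENNReal.rpow_le_rpow hb_le (by norm_num : (0 : ℝ) ≤ 3)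
  rw [hb, ← ENNReal.rpow_mul, show (1 / 3 : ℝ) * 3 = 1 by norm_num, ENNReal.rpow_one,
    eLpNorm_three_eq_lintegral_cube_rpow, ← ENNReal.rpow_mul,
    show (1 / 3 : ℝ) * 3 = 1 by norm_num, ENNReal.rpow_one] at h3
  exact h3

/-- The rescaled pressure `μ² p ∘ Φ_μ` is a.e. strongly measurable on `Q(a)` as soon as
`aμ ≤ 1/2`, if `p` is so on `Q(z₀, 1/2)`. [folklore] -/
theorem aestronglyMeasurable_uncurry_zoom_pressure_of
    {z₀ : ℝ × EuclideanSpace ℝ (Fin 3)}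
    (hp : AEStronglyMeasurable (uncurry p) (volume.restrict (parabolicCylinder (1 / 2) z₀)))
    {μ a : ℝ} (hμ : 0 < μ) (ha : 0 < a) (haμ : a * μ ≤ 1 / 2) :
    AEStronglyMeasurable (uncurry (μ ^ 2 • stPull (μ ^ 2) μ z₀.1 z₀.2 p))
      (volume.restrict (parabolicCylinder a (0 : ℝ × EuclideanSpace ℝ (Fin 3)))) := by
  have hp' : AEStronglyMeasurable (uncurry p) (volume.restrict (parabolicCylinder (a * μ) z₀)) :=
    hp.mono_measure (Measure.restrict_mono
      (parabolicCylinder_mono (by positivity) haμ z₀) le_rfl)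
  have hpre : stAffine (μ ^ 2) μ z₀.1 z₀.2 ⁻¹' parabolicCylinder (a * μ) z₀ =
      parabolicCylinder a (0 : ℝ × EuclideanSpace ℝ (Fin 3)) := by
    rw [zoom_preimage_parabolicCylinder hμ, mul_div_cancel_right₀ a hμ.ne']
  have hcomp : AEStronglyMeasurable (uncurry p ∘ stAffine (μ ^ 2) μ z₀.1 z₀.2)
      (volume.restrict (parabolicCylinder a (0 : ℝ × EuclideanSpace ℝ (Fin 3)))) := by
    rw [← hpre]
    refine hp'.comp_quasiMeasurePreserving ⟨measurable_stAffine _ _ _ _, ?_⟩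
    rw [map_stAffine_volume_restrict_preimage (pow_pos hμ 2) hμ]
    exact Measure.smul_absolutelyContinuous
  have e : uncurry (μ ^ 2 • stPull (μ ^ 2) μ z₀.1 z₀.2 p) =
      (μ ^ 2) • (uncurry p ∘ stAffine (μ ^ 2) μ z₀.1 z₀.2) := by
    funext z; rfl
  rw [e]
  exact hcomp.const_smul (μ ^ 2)

/-- **The bound on `D` passes to the blow-up limit** (the ESS-class version is `blowup_cknD_le`; Seregin 2014, Prop. 6.20: the scale
invariant quantities of the local energy ancient solution are bounded; ESS 2003, §3 (3.15)): if
`D(r; z₀) ≤ D⋆` for `0 < r ≤ 1/2` and the rescaled pressures `μ_j² p ∘ Φ_{μ_j}` converge weakly in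
`L^{3/2}(Q(a))` (tested against `L³(Q(a))`) to `π ∈ L^{3/2}(Q(a))`, then `D(a; 0)[π] ≤ D⋆`
(`∫_{Q(a)} |p^{μ_j}|^{3/2} = a² D(aμ_j; z₀) ≤ a² D⋆`, and the `L^{3/2}` norm is weakly lower
semicontinuous: test against `π/√|π| ∈ L³`). [cite: Seregin2014, §6.6 Prop. 6.20] [cite: EscauriazaSereginSverak2003, §3 (3.15)] -/
theorem blowup_cknD_le_of
    {z₀ : ℝ × EuclideanSpace ℝ (Fin 3)}
    (hp : AEStronglyMeasurable (uncurry p) (volume.restrict (parabolicCylinder (1 / 2) z₀)))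
    {δ : ℕ → ℕ} (hδge : ∀ k, k ≤ δ k) {π : ℝ → EuclideanSpace ℝ (Fin 3) → ℝ} {D : ℝ≥0} {a : ℝ}
    (hD : ∀ r ∈ Ioc (0 : ℝ) (1 / 2), cknD r z₀ p ≤ D) (ha : 0 < a)
    (hπ : MemLp (uncurry π) (3 / 2)
      (volume.restrict (parabolicCylinder a (0 : ℝ × EuclideanSpace ℝ (Fin 3)))))
    (hweak : ∀ g : ℝ × EuclideanSpace ℝ (Fin 3) → ℝ,
      MemLp g 3 (volume.restrict (parabolicCylinder a (0 : ℝ × EuclideanSpace ℝ (Fin 3)))) →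
      Tendsto (fun j => ∫ w' in parabolicCylinder a (0 : ℝ × EuclideanSpace ℝ (Fin 3)),
          ((((1 / 2 : ℝ) ^ (δ j + 2)) ^ 2) •
            stPull (((1 / 2 : ℝ) ^ (δ j + 2)) ^ 2) ((1 / 2 : ℝ) ^ (δ j + 2)) z₀.1 z₀.2 p)
              w'.1 w'.2 * g w')
        atTop (𝓝 (∫ w' in parabolicCylinder a (0 : ℝ × EuclideanSpace ℝ (Fin 3)),
          π w'.1 w'.2 * g w'))) :
    cknD a (0 : ℝ × EuclideanSpace ℝ (Fin 3)) π ≤ D := by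
  haveI : ENNReal.HolderTriple (3 / 2 : ℝ≥0∞) 3 1 := holderTriple_threeHalves_three_one'
  set lam : ℕ → ℝ := fun n => (1 / 2 : ℝ) ^ (n + 2) with hlam
  have hlam_pos : ∀ n, 0 < lam n := fun n => by positivity
  obtain ⟨j₀, hj₀⟩ := eventually_scale_mul_le_half hδge ha
  set P : ℕ → ℝ → EuclideanSpace ℝ (Fin 3) → ℝ :=
    fun j => (lam (δ j)) ^ 2 • stPull ((lam (δ j)) ^ 2) (lam (δ j)) z₀.1 z₀.2 p with hP
  set μ' : Measure (ℝ × EuclideanSpace ℝ (Fin 3)) :=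
    volume.restrict (parabolicCylinder a (0 : ℝ × EuclideanSpace ℝ (Fin 3))) with hμ'
  have ha2 : (ENNReal.ofReal a ^ 2) ≠ 0 := pow_ne_zero _ ((ENNReal.ofReal_pos.2 ha).ne')
  have ha2' : (ENNReal.ofReal a ^ 2) ≠ ∞ := ENNReal.pow_ne_top ENNReal.ofReal_ne_top
  obtain ⟨h32, h32', h32r⟩ := threeHalves_facts
  have h320 : (3 / 2 : ℝ≥0∞) ≠ 0 := (zero_lt_one.trans_le h32).ne'
  -- ## the approximants: bound and measurability for `j ≥ j₀`
  have hPk : ∀ j, j₀ ≤ j → ∫⁻ w, ‖uncurry (P j) w‖ₑ ^ (3 / 2 : ℝ) ∂μ' ≤ ENNReal.ofReal a ^ 2 * D := by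
    intro j hj
    have e : ∫⁻ w, ‖uncurry (P j) w‖ₑ ^ (3 / 2 : ℝ) ∂μ' =
        ∫⁻ w in parabolicCylinder a ((0 : ℝ), (0 : EuclideanSpace ℝ (Fin 3))),
          ‖((lam (δ j)) ^ 2 • stPull ((lam (δ j)) ^ 2) (lam (δ j)) z₀.1 z₀.2 p) w.1 w.2‖ₑ ^
            (3 / 2 : ℝ) := rfl
    rw [e, lintegral_pressure_zoom_radius (hlam_pos _) ha z₀ p]
    exact mul_le_mul' le_rfl (hD _ ⟨by positivity, hj₀ j hj⟩)
  have hPm : ∀ j, j₀ ≤ j → AEStronglyMeasurable (uncurry (P j)) μ' :=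
    fun j hj => aestronglyMeasurable_uncurry_zoom_pressure_of hp (hlam_pos _) ha (hj₀ j hj)
  -- ## the test function `g = π / √|π|`
  set N := ∫⁻ w, ‖uncurry π w‖ₑ ^ (3 / 2 : ℝ) ∂μ' with hN
  have hNtop : N ≠ ∞ := by
    have h1 := hπ.eLpNorm_lt_top
    rw [eLpNorm_eq_lintegral_rpow_enorm_toReal h320 h32', h32r] at h1
    exact ((ENNReal.rpow_lt_top_iff_of_pos (by norm_num)).1 h1).ne
  set g : ℝ × EuclideanSpace ℝ (Fin 3) → ℝ := fun w => uncurry π w / Real.sqrt |uncurry π w|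
    with hgdef
  have hgm : AEStronglyMeasurable g μ' :=
    (hπ.1.aemeasurable.div
      (continuous_abs.measurable.comp_aemeasurable hπ.1.aemeasurable).sqrt).aestronglyMeasurable
  have hg3 : ∫⁻ w, ‖g w‖ₑ ^ (3 : ℝ) ∂μ' = N :=
    lintegral_congr fun w => enorm_div_sqrt_abs_rpow_three _
  have hgmem : MemLp g 3 μ' := by
    refine ⟨hgm, ?_⟩
    rw [eLpNorm_eq_lintegral_rpow_enorm_toReal (by norm_num) (by norm_num), ENNReal.toReal_ofNat,
      hg3]
    exact ENNReal.rpow_lt_top_of_nonneg (by norm_num) hNtop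
  -- ## Step A: `∫ π g = N`
  have hA : ENNReal.ofReal (∫ w, uncurry π w * g w ∂μ') = N := by
    have hPg : ∀ w, uncurry π w * g w = |uncurry π w| ^ (3 / 2 : ℝ) := fun w =>
      mul_div_sqrt_abs_eq_rpow (uncurry π w)
    have hint : Integrable (fun w => uncurry π w * g w) μ' := hπ.integrable_mul hgmem
    have hnn : 0 ≤ᵐ[μ'] fun w => uncurry π w * g w :=
      Eventually.of_forall fun w => by simp only [Pi.zero_apply]; rw [hPg]; positivity
    rw [ofReal_integral_eq_lintegral_ofReal hint hnn]
    refine lintegral_congr fun w => ?_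
    rw [hPg, ← ENNReal.ofReal_rpow_of_nonneg (abs_nonneg _) (by norm_num),
      ← Real.enorm_eq_ofReal_abs]
  -- ## Step B: Hölder bound on the approximants, `j ≥ j₀`
  have hB : ∀ j, j₀ ≤ j → ‖∫ w, uncurry (P j) w * g w ∂μ'‖ₑ ≤
      (ENNReal.ofReal a ^ 2 * D) ^ (2 / 3 : ℝ) * N ^ (1 / 3 : ℝ) := by
    intro j hj
    refine (enorm_integral_le_lintegral_enorm _).trans ?_
    have hH := ENNReal.lintegral_mul_le_Lp_mul_Lq μ'
      (Real.holderConjugate_iff.2 ⟨by norm_num, by norm_num⟩ : (3 / 2 : ℝ).HolderConjugate 3)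
      (hPm j hj).aemeasurable.enorm hgm.aemeasurable.enorm
    simp only [Pi.mul_apply] at hH
    calc ∫⁻ w, ‖uncurry (P j) w * g w‖ₑ ∂μ' = ∫⁻ w, ‖uncurry (P j) w‖ₑ * ‖g w‖ₑ ∂μ' := by
          simp_rw [enorm_mul]
      _ ≤ (∫⁻ w, ‖uncurry (P j) w‖ₑ ^ (3 / 2 : ℝ) ∂μ') ^ (1 / (3 / 2 : ℝ)) *
            (∫⁻ w, ‖g w‖ₑ ^ (3 : ℝ) ∂μ') ^ (1 / (3 : ℝ)) := hH
      _ ≤ (ENNReal.ofReal a ^ 2 * D) ^ (2 / 3 : ℝ) * N ^ (1 / 3 : ℝ) := by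
          rw [hg3, show (1 / (3 / 2 : ℝ)) = 2 / 3 by norm_num]
          gcongr
          exact hPk j hj
  -- ## Step C: weak convergence tested against `g`
  have hC : Tendsto (fun j => ∫ w, uncurry (P j) w * g w ∂μ') atTop
      (𝓝 (∫ w, uncurry π w * g w ∂μ')) := hweak g hgmem
  -- ## Step D: pass to the limit in the Hölder bound
  have hDlim : N ≤ (ENNReal.ofReal a ^ 2 * D) ^ (2 / 3 : ℝ) * N ^ (1 / 3 : ℝ) :=
    calc N = ENNReal.ofReal (∫ w, uncurry π w * g w ∂μ') := hA.symm
      _ ≤ ‖∫ w, uncurry π w * g w ∂μ'‖ₑ := Real.ofReal_le_enorm _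
      _ ≤ (ENNReal.ofReal a ^ 2 * D) ^ (2 / 3 : ℝ) * N ^ (1 / 3 : ℝ) :=
          le_of_tendsto hC.enorm (eventually_atTop.2 ⟨j₀, fun j hj => hB j hj⟩)
  -- ## Step E: `N ≤ a² D`
  have hE : N ≤ ENNReal.ofReal a ^ 2 * D := by
    rcases eq_or_ne N 0 with hN0 | hN0
    · rw [hN0]; exact zero_le
    have h1 : N ^ (2 / 3 : ℝ) ≤ (ENNReal.ofReal a ^ 2 * D) ^ (2 / 3 : ℝ) := by
      have h13 : N ^ (1 / 3 : ℝ) ≠ 0 := by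
        intro h0
        rcases ENNReal.rpow_eq_zero_iff.1 h0 with ⟨h00, -⟩ | ⟨-, hneg⟩
        · exact hN0 h00
        · norm_num at hneg
      have h13' : N ^ (1 / 3 : ℝ) ≠ ∞ := ENNReal.rpow_ne_top_of_nonneg (by norm_num) hNtop
      have e : N ^ (2 / 3 : ℝ) * N ^ (1 / 3 : ℝ) = N := by
        rw [← ENNReal.rpow_add _ _ hN0 hNtop]; norm_num
      rw [← ENNReal.mul_le_mul_iff_left h13 h13', e]
      exact hDlim
    have h2 := ENNReal.rpow_le_rpow h1 (by norm_num : (0 : ℝ) ≤ 3 / 2)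
    rwa [← ENNReal.rpow_mul, ← ENNReal.rpow_mul, show (2 / 3 : ℝ) * (3 / 2) = 1 by norm_num,
      ENNReal.rpow_one, ENNReal.rpow_one] at h2
  rw [cknD]
  exact (ENNReal.inv_mul_le_iff ha2 ha2').2 hE

end Properties

end Literature.Analysis.FluidPDE

end
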